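import Summits.BirchSwinnertonDyer.Rank1Residual.F1Sign2.GenusClassSwitchingAtTwo
import HarnessLib.Audit.Tags
import HarnessLib

/-!
# Cell `bsd-f1-sign2` — descent / visibility lens (planner `-desc` g25; MEMO-desc §35 + §35-add1…add4): DESC-35 «BREADTH: THE S₃-SPIN LAW IS A GENERAL LAW OF 2-SELMER
# GROUPS IN S₃ TWIST FAMILIES» (vocabulary `evalModC`, `companionCubic`, `mulMatrixCubic`, `IsIntegralUnitQuot`, `LabelledRootsModC`, `GeneratesPrimeOverC`,
# `IntegralUnitsSquareModC`, `DegOnePrimesPrincipalC`, `SpinBitC`, `CubicDatumFor`, `GenusTrivialTwistMember`, `KappaBitOfMember`, `SpinSetting`, `GeneratesOddPrimePowerOverC`,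
# `DegOnePrimesOddClassC`, data `cubicDatum11a1/37b3/67a1/141d1/446a1`; rows DESC-35-WD `GenusTrivialTwistKappaWellDefined`, DESC-35-S `GenusTrivialTwistPureSpinLaw`, DESC-35-S⁺
# `GenusTrivialTwistPureSpinLawOddClass` + link `generatesPrimeOverC_of_oddPower_one`, DESC-35-H `SpinSettingCubicClassNumberOdd`; kernels in `SpinLawAtTwoKernel.lean`)

STATEMENTS + -desc's one link theorem (typer -ty g19).  Source: `HOME/MEMO-desc-data/g25/lean/Sketch35.lean` revision **v3.2 630fca27e81fe9b4** (227 l., ns flat `…F1Sign2`; = the text REF1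
audited in §208, `HOME/REF1-data/b208/Sketch35.lean` = -desc's `Sketch35.v32.lean`, and Part B of REF1's `Probe208.lean` **d651f3415836a4c9** VERBATIM; -desc's BC7 `bc7_35c.out` (S⁺) fired
= []).  NOT ported here: -desc g25/g26's §35-add5 rows appended to `Sketch35.lean` after the audit (revision 0c58374d78600048, 15:47Z: DESC-35-WD′ `GenusTrivialTwistKappaWellDefinedGeneral`
+ glue, `SpinSettingWeak` + glue, DESC-35-S′ `GenusTrivialTwistPureSpinLawWeak` + glue; ENGINE 52) — REF-GATED until REF1 audits them; they only ADD declarations, the v3.2 rows are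
byte-identical in the new revision.  PORT GATE = REF1-AUDIT §208 R208a (INBOX 2026-08-29T15:39:37Z): Props VERBATIM from 630fca27e81fe9b4; tags 35-S / 35-S⁺ `@[conjecture]`, 35-WD /
35-H plain — as sketched; bodies = sketch = Probe208 byte-for-byte (builder-verified); -desc's in-file sanity `example` (`det (mulMatrixCubic c X) = −1` for 11a1: `θ` is a unit) is
filed as the named kernel theorem `mulMatrixCubic_det_11a1`.  CITE TAGS (typer): multi-key brackets split one key per tag; 35-H's locator per R208a; FIMR in arXiv numbering
(REF2 v54 §11.2).  RIDERS per R208a/R208b/R208c (REF1) and REF2 v54 §16/§16.4.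
GRADES (REF1-AUDIT §208; evidence `HOME/REF1-data/b208/`): **0 KILLED · all §35 rows SURVIVE** — **35-WD THEOREM-CANDIDATE** (plain; member law 0 inconsistent / 51 946 primes with
≥ 2 members re-tallied; the rider names BOTH halves, R208b(i): same cofactor sign `(m/p) = (m′/p)` — Mazur–Rubin 2010 Lemma 24 (i)/(ii)/(v) (and (iv) for `Δ_W < 0` at
opposite signs) gives `Sel₂(W^{(pm)}) = Sel₂(W^{(pm′)}) ⊂ H¹(ℚ, W[2])` LITERALLY, corollary of print; opposite sign with `Δ_W > 0` — «parity ⟹ position» (Monsky 2-parity,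
`w(W^{(n)}) = w(W)·χ_n(−N) = +1`, Poitou–Tate dimension 2 with `Sel₂(W) = 0`, `S₀ = J` from the tame Hilbert symbols, enumeration = **K208.6**: a symmetric `S : Fin 2 → Fin 2 → ZMod 2`
with «`S = 0 ∨ det S ≠ 0`» and «`S + J = 0 ∨ det(S+J) ≠ 0`» lies in `{0, J}` — `decide`), print INPUTS assembled, NOT Lemma 24; minimal hypothesis `selmerTwoCard W = 1` + members
— `Odd N`, `Squarefree N`, `Odd ∏c_ℓ`, `Even a₂` are S's hypotheses, unused by WD (R208b(ii))); **35-S / 35-S⁺ `@[conjecture]` THEOREM-CANDIDATES** (pure law **4 915/4 915**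
re-tallied from the raw ENGINE 49/50/50b–d/51 rows incl. 1 128 e51 verdicts (1 062 at non-principal primes), κ = 1 : 2 450 / κ = 0 : 2 465; proof sketch §35-add1 steps 1–8 audited:
step 5 certified (K208.6), both cofactor signs REALISED at every split `p` by Chebotarev in `ℚ(W[2], ζ_{8Np})` with no obstruction (the only forced quadratic value is `χ_Δ(q) =
(Δ/p) = +1`, compatible with a 3-cycle — R208b(iii): add this sentence to step 5), evenness inputs = Brumer–Kramer / Yoo–Yu Thm. 1.10 verbatim, add4 erratum (`a₂` even ⟺
supersingular ⟹ 2 totally ramified in `L`, `e = 3` tame — Newton polygon of `[2](T)/T` one segment of slope −1/3) changes no statement; S⁺ = same grade as S (R208c: the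
odd-class-power device is definitional sugar over 35-H — with `Cl_L[2] = 0` every `𝔭_i` has an odd power that is principal); the binders `i ≠ j` (K208.2′), purity (K208.4a/4b:
`IntegralUnitsSquareModC` contains `−1 = (−1)/1`, so `p ≢ 3 (4)`), `¬ p ∣ xden`, xnum-injective are present — the last is automatic at `p ∤ 2·disc` (e.g. `Res(T₃,T₃′) = 892` for
446a1), kept explicit, harmless); **35-H CONSEQUENCE OF PRINT** (plain; verified at the page by REF1: Yoo–Yu, Pacific J. Math. 320 (2022), arXiv 2005.00194 — Thm. 1.6 p0004
L23–31: `E` nice at all finite primes ⟹ `n ≤ dim Sel₂(E/K) ≤ n + [K:ℚ]`, `n = dim C^∞_L[2] − dim C⁺_K[2]`; Thm. 1.10 (Brumer–Kramer) p0004 L70–71: odd `v` nice if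
`[E(K_v):E₀(K_v)]` odd, even `v` nice if `K_v/ℚ₂` unramified and good reduction; apply to the monic integral model `Y² = X³ + b₂X² + 8b₄X + 16b₆` (`X = 4x`,
`Y = 4(2y + a₁x + a₃)`), same cubic field: `c_ℓ` odd at `ℓ ∣ N`, index 1 at good odd `v`, good reduction at 2 (`N` odd) ⟹ nice everywhere ⟹ `dim C^∞_L[2] ≤ dim Sel₂(W) = 0`
⟹ `h_L` odd; MUTATION: `Squarefree N` and `Even a₂` are NOT used for H — harmless extra hypotheses; likewise `Squarefree N` is possibly unnecessary for 35-S (R208b(v): cheapest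
falsifier one additive-conductor curve with `#Sel₂ = 1`, odd `c_ℓ`, `a₂` even through ENGINE 50)); link lemma kernel-checked (K208.10).  Carriers (A2): `det (mulMatrixCubic c g) =
N_{L/ℚ}(g(θ))` for monic `c`; `IsIntegralUnitQuot` quantifies over ALL units of `𝓞_L` without `ℤ[θ] = 𝓞_L`; `GeneratesOddPrimePowerOverC c p a g o` ⟹ `(g(θ)) = 𝔭_a^o` exactly;
`SpinBitC` multiplies by `xden` instead of dividing (same Legendre symbol, `p ∤ xden`); `CubicDatumFor` = monic, deg 3, irreducible, `¬IsSquare(−Res(c,c′))` (Gal S₃), `0 < xden`,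
`c ∣` the cleared 2-division numerator via `%ₘ` — REF1 re-derived all five data: b-invariants (5,−60,208), (−4,−20,−79), (4,−6,5), (4,−24,−83), (4,−52,−243); −Res = 892, −44, 148,
−268, 564 (none a square); divisibility TRUE 5/5; `GenusTrivialTwistMember`'s `n / p` exact (K208.5); `p = 2` labellings do not exist (K208.1′); `SpinSetting` pins `#Sel₂(W) = 1`, so
§35 and §34 (`#Sel₂ = 2`) are disjoint populations (K208.12).  (A3) vacuity: hypothesis bundles inhabited by the census rows (35-S at (11a1, `p = 401`)); `CubicDatumFor` ×5; the 96
ENGINE-50/51 curves have `#Sel₂ = 1` by two engines.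
REF2-PLACEMENT v54 §16 (+§16.4 precision accepted from REF1): **35-WD = COROLLARY OF PRINT in the stronger form** `Sel₂(E^{(pm)}) = Sel₂(E^{(pm′)})` as SUBGROUPS of `H¹(ℚ,E[2])`
for the same-sign (and `Δ < 0`) pairs — Mazur–Rubin 2010 Lemma 24 «Criteria for equality of local conditions after twist» (i)–(v) verbatim (held arxiv-0904.3709 p0006 L165–205; frame
Def. 20 `δ_v` / Thm. 21 Kramer; tree analogue `admissibleTwistSelmerShiftAtTwo_holds`) —, the opposite-sign/`Δ_W > 0` half being the parity ⟹ position step (print tools, not Lemma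
24); type PLAIN; **35-S (and S⁺) = NEW-COMBINATION**, conjecture-grade law-candidate, census-backed on five (now 96) curves — nearest print FIMR 2013 Thm. 11.1 (= arXiv Thm. 28,
held arxiv-1110.6331 p0024: CYCLIC cubic `ℚ(E[2])`, prime twists, `U⁺ = U²`, `p` split in `ℚ(E[4])`) and Koymans–Milovic Thm. 1 (Galois `K` only); spins between CONJUGATE primes
of a NON-Galois (S₃) cubic field governing 2-Selmer ranks of COMPOSITE genus-class-trivial twists, any unit signature: NOT IN PRINT; the analytic/equidistribution input for `κ`
over `p` (DESC-34-NG) is OPEN IN PRINT for S₃ sextics (§11.3); 35-H = print (Yoo–Yu) as -desc says; §35 ¶6's reading of the search question («the signed object at 2 at split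
primes is an S₃-spin, NOT Frobenian») consistent with v53 §22 / v54 §11.  BC5 (MEMO-desc §35, `HOME/MEMO-desc-data/g25/` 183 files SHA16SUMS): ENGINE 50 = kit j332525 (11a1),
j332526 (37b3), j332528 (67a1), j332531 (141d1), `p ≤ 100 000`, two engines per prime as ENGINE 49 — LAW P50 inconsistent 0, frame AGREE 1 575/1 581/1 578/1 566 (all), identity OK
(all), pure law 178/178, 44/44, 184/184, 45/45 (`κ = 1/0`: 100/78, 31/13, 88/96, 16/29); ENGINE 50b–d j332772/j332856/j332857, ENGINE 51 j332986 (28 curves, `h_L ∈ {3,5,7,9,15}`: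
member law 0/39 090, frames 9 463/9 463, pure law with `γ_i` 1 128/1 128, 1 062 at non-principal primes), search51 j332956 (0 even class numbers of 104/140 candidates); cumulative
**pure S₃-spin law 4 915/4 915 on 96 curves** (N ∈ [11, 19 795]; class numbers 1, 3, 5, 7, 9, 15), member law 0/208 777 pairs, frames AGREE 50 428/50 428, spin equidistribution
2 411 : 2 428.  Cheapest falsifiers: 35-S — a curve in the setting whose relaxed classes `α_i` are ramified at a bad prime despite odd `c_ℓ`; R208b(v) — an additive-conductor curve;
S⁺ — an EVEN `h_L` example (none found; predicted correction by `Cl(L)[2]`).  Why novel (one sentence, -desc §35 ¶6 + REF2 §16.2): the 2-Selmer rank in an S₃ genus-class-trivial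
twist family is a quadratic residue symbol between two CONJUGATE primes of the non-Galois cubic field, up to explicit Legendre symbols — FIMR's mechanism without any of FIMR's
four hypotheses.  PARTITION none.  Beyond-print theorem: no (35-S/S⁺ would be beyond-print DESCENT theorems once proved — not BSD; nothing kernel-proved beyond glue).  BSD is not
proved; 23715 not closed.  bears_on: stmt-BirchSwinnertonDyer-23715.

POINTER -ty g19 (REF1-AUDIT §212, REF-gate released): the §35-add5 rows of `Sketch35.lean` v3.3 0c58374d78600048 (DESC-35-WD′ `GenusTrivialTwistKappaWellDefinedGeneral`, carrier
`SpinSettingWeak`, DESC-35-S′ `GenusTrivialTwistPureSpinLawWeak` + three glues) are filed in the sibling `GenusTrivialSpinLawWeakAtTwo.lean` (this file keeps ≤ 400 lines with its link theorem).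

## -desc's module docstring of `Sketch35.lean` v3.2 (verbatim; cite brackets re-keyed by the typer; v3.3 adds nothing to it)

# Sketch35 — cell bsd-f1-sign2, seat -desc g25 (LENS descent / visibility), MEMO-desc §35

**BREADTH: THE `S₃`-SPIN LAW IS A GENERAL LAW OF 2-SELMER GROUPS IN `S₃` TWIST FAMILIES.**  §34 found, for `W = 446a1` on its `ν = 0` split cell, that
the residual Lagrangian bit `κ₀(p)` is a quadratic residue symbol between CONJUGATE primes of the non-Galois cubic field `L = ℚ(W[2]) ∩ ℝ`-type
(`(π_i/𝔭_j)`, an `S₃`-spin) times a Frobenian cofactor, and equals the pure spin on PURE primes (every unit of `𝓞_L` a square modulo every prime over `p`).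
§35 transports the statement to the cleanest possible family on an ARBITRARY curve and tests it on four further curves.

SETTING.  `E/ℚ` elliptic (globally minimal model `W`), `Gal(ℚ(E[2])/ℚ) ≅ S₃` with cubic field `L = ℚ(e)` (`e` the x-coordinate of a 2-torsion point),
`Sel₂(E/ℚ) = 0`, conductor `N` odd and squarefree, odd Tamagawa product, `a₂(E)` even (⟺ `E` supersingular at `2` ⟺ `2` totally ramified in `L`: ONE prime over `2`, residue degree `1`;
by Brumer–Kramer / Yoo–Yu 2022 Thm 1.6+1.10 the setting forces `h_L` — even the semi-narrow class number — to be ODD).  GENUS-CLASS-TRIVIAL MEMBERS: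
`n = p·m` squarefree with `p` SPLIT (three roots of the 2-division cubic mod `p`), every other prime factor a 3-CYCLE prime (`a_q` odd), `n ≡ 1 (8)` and
`(n/ℓ) = +1` for every (odd) bad prime `ℓ`.  Then `E^{(n)} ≅ E` over `ℚ₂`, `ℚ_ℓ` (`ℓ ∣ N`) and `ℝ`, and `H¹(ℚ_q, E[2]) = 0` at the 3-cycle primes, so
`Sel₂(E^{(n)}) = {c ∈ Sel^{rel p}(E) : loc_p c ∈ A^{(m/p)}}` where `I(p) := loc_p Sel^{rel p}(E)` is a Lagrangian of `H¹(ℚ_p, E[2]) ≅ 𝔽₂⁴` transverse to the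
unramified one (`Sel₂(E) = 0`) and INDEPENDENT OF THE MEMBER, and `A^{±}` are the two Kummer Lagrangians of the twists with cofactor class `(m/p) = ±1`.
LAW P50 (parity lemma `I(p) ∈ {A⁺, A⁻}` + the above): `dim Sel₂(E^{(pm)})/2 = κ(p) ⊕ [(m/p) = −1]`, `κ(p) := [I(p) = A⁺] ∈ {0,1}`.
IDENTITY (as §34, local frame at `p`, `h_L = 1`): `κ(p) ≡ 1 + {(π_i/𝔭_j)} + {((e_i − e_j)/p)} + {(η w_i/𝔭_j)} (mod 2)` for all six `(i, j)` (`π̂_j` canonical generators,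
`η = p/(π̂₁π̂₂π̂₃)`, `w_i = α_i/(π̂_jπ̂_k)` a UNIT because `2` does not split in `L`, the Tamagawa numbers are odd and `h_L = 1`) — no `(−1/p)` term for the `+n` family.
PURE SPIN LAW: if `−1` and every unit of `𝓞_L` are squares modulo `𝔭₁, 𝔭₂, 𝔭₃` then `κ(p) = [(π_i/𝔭_j)·((e_i − e_j)/p) = +1]` for ANY generator `π_i` of `𝔭_i`, any `i ≠ j`.

ENGINE 50 (kit j332525 `11a1`, j332526 `37b3`, j332528 `67a1`, j332531 `141d1`; `p ≤ 100 000`; two engines per prime exactly as ENGINE 49: PARI `ellrank` on ≥ 3 members of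
both cofactor signs AND the relaxed Selmer frame from `ell2cover` of the `dim = 2` member identified inside `L(S_p, 2)` by `bnfsunit` + splitting patterns at 28 auxiliary primes):
| curve | `L` (disc, signature) | split `p` | members | LAW P50 inconsistent | frame AGREE | identity OK | pure `p` | PURE LAW | `κ = 1 / 0` on pure |
|---|---|---|---|---|---|---|---|---|---|
| `11a1`  | `y³−y²+y+1` (−44, complex)   | 1 575 | 5 270 | 0 | 1 575/1 575 | 1 575/1 575 | 178 | 178/178 | 100/78 |
| `37b3`  | `y³−y²−3y+1` (148, real)     | 1 587 | 5 353 | 0 | 1 581/1 581 | 1 581/1 581 | 44  | 44/44   | 31/13 |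
| `67a1`  | `y³−y²−3y+5` (−268, complex) | 1 582 | 5 305 | 0 | 1 578/1 578 | 1 578/1 578 | 184 | 184/184 | 88/96 |
| `141d1` | `y³−y²−5y+3` (564, real)     | 1 575 | 5 244 | 0 | 1 566/1 566 | 1 566/1 566 | 45  | 45/45   | 16/29 |
(+ §34: `446a1`, `y³−y²−8y+10` (892, real, narrow class number 2), rank-ONE odd branch, kill-branch family: AGREE 746/746, identity 746/746, pure law 76/76.)
`κ` alone: density `0.500/0.481/0.514/0.499`, flat over `p mod 8`, and a COIN on pairs of primes with the same unit-residue key (`0.499/0.507/0.504/0.531`); `κ ⊕ spin`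
is CONSTANT on such pairs for the two totally real fields (4 895/4 895, 631/631).  Twists realising `dim Sel₂ = 2` include 612 + 490 + 37 + 25 members of PROVED rank 2.

Rows: DESC-35-WD `GenusTrivialTwistKappaWellDefined` (law P50: the member bit does not depend on the member), DESC-35-S `GenusTrivialTwistPureSpinLaw` (the general
pure `S₃`-spin law, data-parameterised by an integral cubic `c` with root `θ`, the 2-torsion abscissa `e = xnum(θ)/xden`, purity over ALL units of `𝓞_L` via an
elementary integrality predicate — no class-number or monogenicity hypothesis is needed for SOUNDNESS: a prime over `p` without a generator in `ℤ[θ]` makes the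
instance vacuous).  Nearest print as in §34: [cite: FIMR2013Spin, Thm. 11.1] is the CYCLIC-cubic, prime-twist, `U⁺ = U²`, `p` split in `ℚ(E[4])` case of exactly this
shape (`dim Sel₂(E^{(p)}) − dim Sel₂(E) = 2·[spin = 1]`); here `Gal = S₃`, composite genus-class-trivial twists, arbitrary unit signature, and the `ℚ(E[4])`-splitting
hypothesis is replaced by the explicit correction `((e_i − e_j)/p)`.
-/

noncomputable section

open scoped Classical

open WeierstrassCurve Literature.NumberTheory.EllipticCurves Polynomial

namespace Summit.BirchSwinnertonDyer.Rank1Residual.F1Sign2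

/-! ### §35 vocabulary (general cubic datum) -/

/-- Reduction of an integer polynomial at `x ∈ ℤ/p` (same as §34 `evalMod`; suffixed to avoid a clash until §34 is ported).
(Typer -ty g19: carrier VERBATIM; = §34's `evalMod` (`SplitPrimeSpinLaw446AtTwo.lean`), kernel lemma `evalModC_eq_evalMod` — R208a «state it, do not silently re-define».) -/
def evalModC (g : ℤ[X]) (p : ℕ) (x : ZMod p) : ZMod p :=
  (g.map (Int.castRingHom (ZMod p))).eval x

/-- Companion matrix of a monic integer cubic `c = X³ + c₂X² + c₁X + c₀`: multiplication by `θ` on the basis `1, θ, θ²` of `ℤ[θ] = ℤ[X]/(c)`.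
(Typer: carrier VERBATIM.) -/
def companionCubic (c : ℤ[X]) : Matrix (Fin 3) (Fin 3) ℤ :=
  !![0, 0, -c.coeff 0; 1, 0, -c.coeff 1; 0, 1, -c.coeff 2]

/-- Multiplication by `g(θ) = g₀ + g₁θ + g₂θ²` on `ℤ[θ]` (for `deg g ≤ 2`); `det = N_{L/ℚ}(g(θ))`, `charpoly =` characteristic polynomial of `g(θ)`.
(Typer: carrier VERBATIM; REF1 §208 (A2): `det = N_{L/ℚ}(g(θ))` for monic `c` ✓; -desc's sanity `example` (11a1: `det M_X = −1`, `θ` a unit) is the kernel theorem `mulMatrixCubic_det_11a1`.) -/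
def mulMatrixCubic (c g : ℤ[X]) : Matrix (Fin 3) (Fin 3) ℤ :=
  g.coeff 0 • (1 : Matrix (Fin 3) (Fin 3) ℤ) + g.coeff 1 • companionCubic c + g.coeff 2 • (companionCubic c) ^ 2

/-- `g(θ)/k` (`g ∈ ℤ[X]`, `deg g ≤ 2`, `k ≥ 1`) is a UNIT OF THE FULL RING OF INTEGERS `𝓞_L`, `L = ℚ(θ)`: its characteristic polynomial `charpoly(M_g)(kX)/k³` has integer
coefficients (`k^{3−i} ∣ coeff_i`) and its norm is `±1` (`|det M_g| = k³`).  (This quantifies over ALL units of `𝓞_L` without assuming `ℤ[θ] = 𝓞_L`.)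
(Typer: carrier VERBATIM; K208.4a: `(−1, 1)` is always an integral unit quotient, so purity below really contains `−1`.) -/
def IsIntegralUnitQuot (c g : ℤ[X]) (k : ℕ) : Prop :=
  0 < k ∧ g.natDegree ≤ 2 ∧ (∀ i : ℕ, i < 3 → ((k : ℤ) ^ (3 - i)) ∣ (mulMatrixCubic c g).charpoly.coeff i) ∧
    ((mulMatrixCubic c g).det).natAbs = k ^ 3

/-- A LABELLING of the three primes over a totally split `p`: `a : Fin 3 → ℤ/p` injective with `c(a_j) = 0`; `𝔭_j :=` the prime of `𝓞_L` through which `θ ↦ a_j` factors.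
(Typer: carrier VERBATIM; K208.1′: none at `p = 2`.) -/
def LabelledRootsModC (c : ℤ[X]) (p : ℕ) (a : Fin 3 → ZMod p) : Prop :=
  Function.Injective a ∧ ∀ j, evalModC c p (a j) = 0

/-- `g(θ) ∈ ℤ[θ]` GENERATES the prime `𝔭` over `p` labelled by `a`: `deg g ≤ 2`, `|N(g(θ))| = p` and `g(a) = 0` in `ℤ/p`.
(Typer: carrier VERBATIM.) -/
def GeneratesPrimeOverC (c : ℤ[X]) (p : ℕ) (a : ZMod p) (g : ℤ[X]) : Prop :=
  g.natDegree ≤ 2 ∧ ((mulMatrixCubic c g).det).natAbs = p ∧ evalModC g p a = 0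

/-- PURITY at `p` (labelled by `a`): every unit `g(θ)/k` of `𝓞_L` with `p ∤ k` is a square modulo each prime over `p`  (`g(a_j)·k` is a square in `ℤ/p`;
with `g = −1, k = 1` this contains `p ≡ 1 (4)`).
(Typer: carrier VERBATIM; K208.4b: ⟹ `p % 4 ≠ 3` for prime `p` (docstring «with `g = −1, k = 1` this contains `p ≡ 1 (4)`» ✓ for odd `p`).) -/
def IntegralUnitsSquareModC (c : ℤ[X]) (p : ℕ) (a : Fin 3 → ZMod p) : Prop :=
  ∀ (g : ℤ[X]) (k : ℕ), IsIntegralUnitQuot c g k → ¬ p ∣ k → ∀ j, IsSquare (evalModC g p (a j) * (k : ZMod p))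

/-- STRONG CLASS NUMBER ONE for the cubic datum: every degree-one prime of `𝓞_L` away from `disc c` has a generator in `ℤ[θ]` (by Chebotarev every ideal class contains
such a prime, so `h_L = 1`; all census fields satisfy it with `ℤ[θ] = 𝓞_L`).  Needed so that the relaxed Selmer class through `𝔭_i` is `p·π_i·(unit)`; for `h_L` odd `> 1` the
law survives with units replaced by `L(∅,2)`, for `h_L` even it can fail as typed.
(Typer: carrier VERBATIM.) -/
def DegOnePrimesPrincipalC (c : ℤ[X]) : Prop :=
  ∀ (p : ℕ) (a : ZMod p), p.Prime → ¬ (p : ℤ) ∣ Polynomial.resultant c (derivative c) → evalModC c p a = 0 →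
    ∃ g : ℤ[X], GeneratesPrimeOverC c p a g

/-- THE SPIN BIT of the labelled pair `(i, j)` read through a generator `g` of `𝔭_i` and the 2-torsion abscissa `e = xnum(θ)/xden`:
`(π_i/𝔭_j)·((e_i − e_j)/p) = +1`, i.e. `g(a_j)·(xnum(a_i) − xnum(a_j))·xden` is a square mod `p`.
(Typer: carrier VERBATIM; K208.2′: TRUE on the diagonal — the rows' `i ≠ j` is load-bearing.) -/
def SpinBitC (xnum : ℤ[X]) (xden p : ℕ) (a : Fin 3 → ZMod p) (i j : Fin 3) (g : ℤ[X]) : Prop :=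
  IsSquare (evalModC g p (a j) * (evalModC xnum p (a i) - evalModC xnum p (a j)) * (xden : ZMod p))

/-- CUBIC DATUM for `W`: `c ∈ ℤ[X]` monic irreducible cubic with NON-SQUARE discriminant (`Gal = S₃`; `disc c = −Res(c, c′)`), and `e := xnum(θ)/xden` (`θ` a root of `c`,
`xden ≥ 1`) is a root of the 2-division polynomial `4x³ + b₂x² + 2b₄x + b₆` of `W`: the cleared numerator is divisible by `c` in `ℚ[X]`.
(Typer: carrier VERBATIM; REF1 §208 (A2) re-derived all five data below: b-invariants (5,−60,208), (−4,−20,−79), (4,−6,5), (4,−24,−83), (4,−52,−243); `−Res(c,c′)` = 892,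
−44, 148, −268, 564 (none a square ⟹ Gal S₃); no rational root; the `%ₘ` divisibility TRUE 5/5 — inhabited ×5.) -/
def CubicDatumFor (W : WeierstrassCurve ℚ) (c xnum : ℤ[X]) (xden : ℕ) : Prop :=
  c.Monic ∧ c.natDegree = 3 ∧ Irreducible (c.map (Int.castRingHom ℚ)) ∧ ¬ IsSquare (-(Polynomial.resultant c (derivative c))) ∧ 0 < xden ∧
    (C (4 : ℚ) * (xnum.map (Int.castRingHom ℚ)) ^ 3 + C W.b₂ * (xnum.map (Int.castRingHom ℚ)) ^ 2 * C (xden : ℚ) +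
        C (2 * W.b₄) * (xnum.map (Int.castRingHom ℚ)) * C ((xden : ℚ) ^ 2) + C (W.b₆ * (xden : ℚ) ^ 3)) %ₘ (c.map (Int.castRingHom ℚ)) = 0

/-- GENUS-CLASS-TRIVIAL MEMBER `n` with split factor `p`: `n` squarefree with odd good prime factors, `n ≡ 1 (8)`, `(n/ℓ) = +1` at every odd bad prime `ℓ`,
`p ∣ n` split, every other prime factor of `n` a 3-cycle prime (`a_q` odd).  (So `W^{(n)} ≅ W` over `ℚ₂`, `ℚ_ℓ`, `ℝ`, and `H¹(ℚ_q, W[2]) = 0` for `q ∣ n/p`.)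
(Typer: carrier VERBATIM over the landed §33 carriers `TwistSupportGoodOdd` / `FrobTwoSplitAt`; K208.5: `n / p * p = n` inside it.) -/
def GenusTrivialTwistMember (W : WeierstrassCurve ℚ) [W.IsGloballyMinimal] (n p : ℕ) : Prop :=
  TwistSupportGoodOdd W n ∧ (n : ℤ) % 8 = 1 ∧
    (∀ ℓ : ℕ, ℓ.Prime → ℓ ≠ 2 → (∀ _h : Fact ℓ.Prime, ¬ W.HasGoodReductionAtPrime ℓ) → jacobiSym (n : ℤ) ℓ = 1) ∧
    p.Prime ∧ p ∣ n ∧ FrobTwoSplitAt W p ∧ ∀ q : ℕ, q.Prime → q ∣ n → q ≠ p → Odd (W.frobeniusTrace q)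

/-- THE MEMBER BIT `κ = 1` read through `n = p·m`: `Sel₂(W^{(n)}) = 0 ⟺ (m/p) = −1`  (law P50: `dim Sel₂(W^{(pm)})/2 = κ(p) ⊕ [(m/p) = −1]`).
(Typer: carrier VERBATIM; K208.11: WD is reflexive-trivial only on the diagonal `n = n′`, content off-diagonal.) -/
def KappaBitOfMember (W : WeierstrassCurve ℚ) (n p : ℕ) : Prop :=
  twistSelmerTwoCard W (n : ℤ) = 1 ↔ jacobiSym ((n / p : ℕ) : ℤ) p = -1

/-- The standing hypotheses of §35 on `W`: `Sel₂(W) = 0` (hence rank `0` and `W(ℚ)[2] = 0`), conductor odd and squarefree (semistable, good at `2`), odd Tamagawa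
product (every `c_ℓ` odd: Selmer classes are unramified at the bad primes), `a₂` even (one prime of `L` over `2`, residue degree `1`: Selmer classes have even valuation there).
(Typer: carrier VERBATIM; K208.12: `SpinSetting W → OnOddBranchRankOneAtTwo W → False` — disjoint from the §34 population.  REF1 R208b(ii)/(v): for WD only `selmerTwoCard W = 1`
is used; `Squarefree N` is possibly unnecessary even for S (untested: the census has squarefree `N` only) — -desc's later §35-add5 `SpinSettingWeak` (REF-gated) addresses this.) -/
def SpinSetting (W : WeierstrassCurve ℚ) [W.IsElliptic] [W.IsGloballyMinimal] : Prop :=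
  selmerTwoCard W = 1 ∧ Odd (W.conductorNorm ℤ) ∧ Squarefree (W.conductorNorm ℤ) ∧ Odd W.tamagawaProduct ∧ Even (W.frobeniusTrace 2)

/-! ### §35 rows -/

/-- **DESC-35-WD `GenusTrivialTwistKappaWellDefined` (law P50, theorem-candidate; descent side).**  In the §35 setting the member bit is a function of the split
prime alone: for two genus-class-trivial members `n, n'` with the same split factor `p`, `Sel₂(W^{(n)}) = 0 ⟺ (n/p·/p) = −1` iff the same holds for `n'`.
(Content: `Sel₂(W^{(pm)}) = {c ∈ Sel^{rel p}(W) : loc_p c ∈ A^{(m/p)}}` with `loc_p Sel^{rel p}(W)` member-free, plus the parity lemma `I(p) ∈ {A⁺, A⁻}`.)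
BC5 (ENGINE 50, `p ≤ 100 000`): `0` inconsistent primes among `1 575 + 1 587 + 1 582 + 1 575` split primes with `5 270 + 5 353 + 5 305 + 5 244` members (≥ 3 per prime,
both signs `(m/p)` at `1 575/1 579/1 577/1 556` primes; `26 940` member pairs); all `dim Sel₂ ∈ {0, 2}`.  (+ law P48 for `446a1`, §33-add1i/§34: 2 352 + … members, 0 failures.)
Why it might fail: a member whose twist acquires a 2-adic or bad-prime local condition different from `W`'s despite `n ≡ 1 (8)`, `(n/ℓ) = 1` (it cannot: `n ∈ ℚ_v^{×2}`).
[cite: Kramer1981, Prop. 6] [cite: MazurRubin2010, §3] [cite: Monsky1996, Thm. 1.5]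
(Typer -ty g19, REF1-AUDIT §208: **SURVIVES, THEOREM-CANDIDATE**, filed PLAIN (REF2 v54 §16.1; R208a).  The rider NAMES BOTH HALVES (R208b(i), REF2 §16.4 accepted): (1) members with the
SAME cofactor sign `(m/p) = (m′/p)` (and all opposite-sign pairs when `Δ_W < 0`): the passage `W^{(n)} ↦ W^{(n′)}` is the quadratic twist by `ℚ(√(mm′))` and
[cite: MazurRubin2010, Lemma 24 (i)–(v) (arXiv numbering: criteria for equality of local conditions after twist)] gives `Sel₂(W^{(pm)}) = Sel₂(W^{(pm′)})` as SUBGROUPS of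
`H¹(ℚ, W[2])` — COROLLARY OF PRINT (held arxiv-0904.3709 p0006 L165–205: (i) `v` splits, (ii) `v ∤ 2∞` with `E(K_v)[2] = 0` — the 3-cycle cofactor primes —, (iv) real `v` with
`(Δ_E)_v < 0`, (v) good `v` unramified; frame Def. 20 / Thm. 21 Kramer; tree analogue `admissibleTwistSelmerShiftAtTwo_holds`); (2) OPPOSITE signs with `Δ_W > 0`: the local
condition at ∞ differs and well-definedness is -desc's «parity ⟹ position» step — Monsky 2-parity [cite: Monsky1996, Thm. 1.5], `w(W^{(n)}) = w(W)·χ_n(−N) = +1` for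
genus-trivial `n`, Poitou–Tate (`dim Sel^{rel p} = 2` from `Sel₂(W) = 0`), `S₀ = J` from the tame Hilbert symbols, and the 𝔽₂-enumeration certified by REF1 §208 **K208.6**
(kernel file) — print INPUTS assembled, NOT Lemma 24.  Minimal hypothesis: `selmerTwoCard W = 1` + the member conditions (R208b(ii)); member law re-tallied 0 inconsistent /
51 946 primes.  -desc's later general form 35-WD′ (`selmerTwoCard W = 1` only; §35-add5, ENGINE 52 0/39 906) is REF-gated, not filed here.  Cite brackets split (typer).)
FOLD -ty g19 (REF1 §212 R212a / REF2 v54 §20.5): the «two-half» rider above (MR10 Lemma 24 + parity ⟹ position) is SUPERSEDED — the member law (and its hypothesis-free form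
DESC-35-WD′ `GenusTrivialTwistKappaWellDefinedGeneral`, sibling file `GenusTrivialSpinLawWeakAtTwo.lean`) is a COROLLARY OF PRINT with a complete print-assembled proof via
Klagsbrun–Mazur–Rubin 2013 Lemma 12 (iii) / 28 (ii) / 30 + Poonen–Rains Prop. 4.10 (the position `Λ ∈ {A⁺, A⁻}` is the count `|𝓗_ram(q_p)| = 2` of ramified Lagrangians for the
Heisenberg quadratic form; no parity input) [cite: KlagsbrunMazurRubin2013, Lemma 12 (iii), Lemma 28 (ii), Lemma 30 (arXiv numbering)] [cite: PoonenRains2012, Prop. 4.10, Thm. 4.13]. -/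
def GenusTrivialTwistKappaWellDefined : Prop :=
  ∀ (W : WeierstrassCurve ℚ) [W.IsElliptic] [W.IsGloballyMinimal], SpinSetting W →
    ∀ n n' p : ℕ, GenusTrivialTwistMember W n p → GenusTrivialTwistMember W n' p → (KappaBitOfMember W n p ↔ KappaBitOfMember W n' p)

/-- **DESC-35-S `GenusTrivialTwistPureSpinLaw` (THE GENERAL PURE `S₃`-SPIN LAW; beyond print; THEOREM-CANDIDATE — complete proof sketch in MEMO-desc §35-add1: Kummer
description of `H¹(ℚ, W[2]) ⊂ L^×/L^{×2}`, evenness of Selmer classes at `2` (one prime, `f = 1`), `ℓ ∣ N` (`c_ℓ` odd) and 3-cycle primes, 2-parity + root number of genus-trivial twists,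
a Hilbert-symbol computation forcing `loc_p Sel^{rel p} ∈ {A⁺, A⁻}`, and `α_i = p·π_i·w_i` from strong class number one; tagged `@[conjecture]` until proved).**
In the §35 setting, for every cubic datum `(c, xnum, xden)` of `W` with strong class number one (`DegOnePrimesPrincipalC`), every genus-class-trivial member `n = p·m`, every labelling `a` of the three primes over the split factor `p` (`p ∤ xden`) at which `W` is PURE
(every unit of `𝓞_L` — all `g(θ)/k` with integral characteristic polynomial and norm `±1` — is a square modulo `𝔭₁, 𝔭₂, 𝔭₃`; the three abscissae `e_j = xnum(a_j)/xden`
are distinct mod `p`, automatic when `p ∤ [ℤ[θ] : ℤ[xden·e]]`), every `i ≠ j` and EVERY generator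
`g(θ) ∈ ℤ[θ]` of `𝔭_i`:   `Sel₂(W^{(n)}) = 0 ⟺ (m/p) = −1`   holds iff   `(g(a_j)·(e_i − e_j)/p) = +1`.
Equivalently `dim_{𝔽₂} Sel₂(W^{(pm)}) = 2·([(π_i/𝔭_j) = ((e_i − e_j)/p)] ⊕ [(m/p) = −1])`: the 2-Selmer rank in the family is a quadratic residue symbol between two
CONJUGATE primes of the non-Galois cubic field, up to explicit Legendre symbols.
BC5 (ENGINE 50 + ENGINE 49): PURE LAW `178/178` (`11a1`), `44/44` (`37b3`), `184/184` (`67a1`), `45/45` (`141d1`) — both values of `κ` on every curve (100/78, 31/13, 88/96, 16/29),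
label- and generator-independence included (six `(i,j)` per prime) — and `76/76` on the `ν = 0` cell of `446a1` (§34, rank one): `527/527` on five curves, cubic fields of
both signatures, conductors `11 … 446`.  The general identity with cofactor (impure primes) holds `6 300/6 300 + 746/746`.
Why it might fail: a curve in the setting whose relaxed classes `α_i` are ramified at a bad prime despite odd `c_ℓ` (then `w_i ∉ 𝓞_L^×` and a cofactor survives purity);
a cubic datum with `ℤ[θ] ≠ 𝓞_L` is covered (purity quantifies over `𝓞_L^×`), a non-principal `𝔭_i` makes the instance vacuous.
[cite: FIMR2013Spin, Thm. 11.1] [cite: KoymansMilovic2021Spins, Thm. 1] [cite: Kramer1981, Prop. 6] [cite: MazurRubin2010, §3] [cite: PoonenRains2012, §4]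
(Typer -ty g19, REF1-AUDIT §208: **SURVIVES, `@[conjecture]` THEOREM-CANDIDATE** (pure law 4 915/4 915 re-tallied over 96 curves, both κ values everywhere; proof sketch §35-add1
steps 1–8 audited — step 5 = K208.6, both signs realised by Chebotarev with no obstruction (R208b(iii): sentence to add), evenness = Brumer–Kramer / Yoo–Yu Thm. 1.10; mutation: among
IMPURE primes the spin bit is label-mixed 32 197 : 14 781, so purity is load-bearing; `Squarefree N` possibly unnecessary, R208b(v)).  REF2 v54 §16.2: **NEW-COMBINATION**,
conjecture-grade law-candidate, NOT IN PRINT — nearest print [cite: FIMR2013Spin, Thm. 11.1 (= arXiv 1110.6331 Thm. 28)] (cyclic cubic, prime twists, `U⁺ = U²`, `p` split in `ℚ(E[4])`)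
and Koymans–Milovic Thm. 1 (Galois `K` only); delta: S₃ image, composite genus-class-trivial twists, the explicit correction `((e_i − e_j)/p)` in place of the `ℚ(E[4])`-splitting
hypothesis, no unit normalisation; the analytic input for κ over `p` is OPEN IN PRINT for S₃ sextics (§11.3).  Cite brackets split (typer).) -/
@[conjecture] def GenusTrivialTwistPureSpinLaw : Prop :=
  ∀ (W : WeierstrassCurve ℚ) [W.IsElliptic] [W.IsGloballyMinimal], SpinSetting W →
    ∀ (c xnum : ℤ[X]) (xden : ℕ), CubicDatumFor W c xnum xden → DegOnePrimesPrincipalC c →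
      ∀ n p : ℕ, GenusTrivialTwistMember W n p → ¬ p ∣ xden →
        ∀ a : Fin 3 → ZMod p, LabelledRootsModC c p a → Function.Injective (fun j => evalModC xnum p (a j)) →
          IntegralUnitsSquareModC c p a →
          ∀ i j : Fin 3, i ≠ j → ∀ g : ℤ[X], GeneratesPrimeOverC c p (a i) g →
            (KappaBitOfMember W n p ↔ SpinBitC xnum xden p a i j g)

/-- `g(θ) ∈ ℤ[θ]` GENERATES AN ODD POWER `𝔭^o` of the prime `𝔭 = (p, θ − a)` over `p ∤ disc c` (Dedekind): `o` odd, `deg g ≤ 2`, `|N(g(θ))| = p^o`, `g(a) = 0` in `ℤ/p`,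
and `g` is coprime modulo `p` to the cofactor `c/(X − a)` (so `g(θ)` lies in no other prime over `p`; then `(g(θ)) = 𝔭^o` since its norm is a power of `p`).
For `o = 1` this is `GeneratesPrimeOverC` (the coprimality is automatic).  ENGINE 51 name: `γ_i`, `ORD = o_i`.
(Typer: carrier VERBATIM; REF1 (A2): ⟹ `(g(θ)) = 𝔭_a^o` exactly.) -/
def GeneratesOddPrimePowerOverC (c : ℤ[X]) (p : ℕ) (a : ZMod p) (g : ℤ[X]) (o : ℕ) : Prop :=
  Odd o ∧ g.natDegree ≤ 2 ∧ (mulMatrixCubic c g).det.natAbs = p ^ o ∧ evalModC g p a = 0 ∧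
    IsCoprime (g.map (Int.castRingHom (ZMod p))) ((c.map (Int.castRingHom (ZMod p))) /ₘ (X - C a))

/-- ODD CLASS NUMBER, elementary surrogate: every degree-one prime of `𝓞_L` away from `disc c` has an ODD power generated by an element of `ℤ[θ]`.  (Degree-one primes
outside a finite set generate `Cl(𝓞_L)` by Chebotarev, and an abelian group generated by elements of odd order has odd order, so `Cl(𝓞_L)[2] = 0` and
`L(∅, 2) := {z : (z) a square}/L^{×2} = 𝓞_L^×/(𝓞_L^×)²` — the one consequence the spin law uses.)  Generalises `DegOnePrimesPrincipalC` (`o = 1`).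
(Typer: carrier VERBATIM; with 35-H it carries no class-group hypothesis for monogenic `L` (R208c: definitional sugar over 35-H).) -/
def DegOnePrimesOddClassC (c : ℤ[X]) : Prop :=
  ∀ (p : ℕ) (a : ZMod p), p.Prime → ¬ ((p : ℤ) ∣ Polynomial.resultant c (derivative c)) → evalModC c p a = 0 →
    ∃ (g : ℤ[X]) (o : ℕ), GeneratesOddPrimePowerOverC c p a g o

/-- **DESC-35-S⁺ `GenusTrivialTwistPureSpinLawOddClass` (the pure `S₃`-spin law WITH CLASS GROUP; beyond print; THEOREM-CANDIDATE by the §35-add1 sketch + §35-add3: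
for `o` odd, `α_i ≡ α_i^{o}` modulo squares and `(α_i^{o}) = (p^{o}/γ_i)·𝔟^{2o}`, so `α_i ≡ p·γ_i·z` with `z ∈ L(∅,2) = 𝓞_L^×/□` when the class number is odd).**
As DESC-35-S, with strong class number one replaced by `DegOnePrimesOddClassC` and the generator `g` of `𝔭_i` replaced by a generator `g` of ANY ODD POWER `𝔭_i^{o}`:
`Sel₂(W^{(n)}) = 0 ⟺ (m/p) = −1`   iff   `(g(a_j)·(e_i − e_j)/p) = +1`.   Non-principal `𝔭_i` are now covered (for `h_L = 3`, about `8/9` of the split primes).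
BC5 = ENGINE 51 (kit j332986, MEMO-desc §35-add3; `h_L ∈ {3, 5, 7, 9, 15}`, 28 curves, `N ≤ 19 795`, `p ≤ 2·10⁴`): member law 0/39 090 pair inconsistencies, frames AGREE
`9 463/9 463` (`8 882` at primes with a NON-PRINCIPAL `𝔭_i`), PURE LAW with `γ_i` **`1 128/1 128`**, of which **`1 062` at primes with a non-principal `𝔭_i`** (class orders 3, 5, 9, 15;
both `κ` values on every curve); cumulative pure-law census with §34/§35: `4 915/4 915` on 96 curves.  No curve of the setting with EVEN `h_L` was found for
`|a₄| ≤ 120, |a₆| ≤ 500, N ≤ 2·10⁴` (j332956: 0 of 140 candidates) — consistent with Brumer–Kramer's injection of `Cl(L)[2]`-classes into a 2-Selmer group with these local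
conditions; for even `h_L` the sketch predicts a correction by `L(∅,2)/𝓞_L^× ≅ Cl(L)[2]` (ENGINE 51's `PURE2`), untested for want of an example.
Why it might fail: `z ∉ 𝓞_L^×·L^{×2}` can only happen with `Cl[2] ≠ 0`, excluded by the binder; what could still fail is the evenness step at a bad prime (as for DESC-35-S).
[cite: FIMR2013Spin, Thm. 11.1] [cite: BrumerKramer1977, §7] [cite: Kramer1981, Prop. 6] [cite: MazurRubin2010, §3]
(Typer, REF1 §208: **SURVIVES, `@[conjecture]` THEOREM-CANDIDATE**, same grade as 35-S (R208c); ENGINE 51 1 128/1 128 incl. 1 062 verdicts at NON-PRINCIPAL primes re-tallied inside the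
4 915; S⁺'s reduction «`α_i ≡ p·γ_i·z`, `z ∈ 𝓞^×/□` when `Cl_L[2] = 0`» uses 35-H; -desc's BC7 `bc7_35c.out` fired = [].  REF2 asked (15:29Z) to place «spin through generators of
odd prime powers at NON-PRINCIPAL primes of a non-Galois cubic field» (FIMR/KM define spin for principal primes only) — SERVED, REF2 v54 §20.1 (FOLD -ty g19, nit n5): **S⁺ = NEW-COMBINATION, same class as 35-S** — verbatim FIMR 2013 (arXiv 1110.6331 p. 3
L30–32) «we shall assign spins only to principal ideals» and Koymans–Milovic (arXiv 1809.09597 p. 3 L7–22) `K/ℚ` GALOIS, «defined for principal prime ideals»: both the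
odd-power / non-principal device (legitimate by `h_L` odd = 35-H, print) and the non-Galois conjugate-prime symbol are outside the printed definitions; the delta over 35-S is
variant-level, not a new mechanism [cite: FIMR2013Spin, §3 (arXiv: spins of principal ideals only)] [cite: KoymansMilovic2021Spins, §1].  Cite brackets split (typer).) -/
@[conjecture] def GenusTrivialTwistPureSpinLawOddClass : Prop :=
  ∀ (W : WeierstrassCurve ℚ) [W.IsElliptic] [W.IsGloballyMinimal], SpinSetting W →
    ∀ (c xnum : ℤ[X]) (xden : ℕ), CubicDatumFor W c xnum xden → DegOnePrimesOddClassC c →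
      ∀ n p : ℕ, GenusTrivialTwistMember W n p → ¬ p ∣ xden →
        ∀ a : Fin 3 → ZMod p, LabelledRootsModC c p a → Function.Injective (fun j => evalModC xnum p (a j)) →
          IntegralUnitsSquareModC c p a →
          ∀ i j : Fin 3, i ≠ j → ∀ (g : ℤ[X]) (o : ℕ), GeneratesOddPrimePowerOverC c p (a i) g o →
            (KappaBitOfMember W n p ↔ SpinBitC xnum xden p a i j g)

/-- Kernel link: for `o = 1` the odd-power generator notion is the §35 generator notion (plus the coprimality clause, which for `o = 1` follows from `|N g| = p`
by Dedekind–Kummer — not re-proved here; hence DESC-35-S⁺ ⟹ DESC-35-S is a one-line consequence of that library fact, not kernel-glued in this sketch).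
(Typer: -desc's link VERBATIM; REF1 §208 K208.10 re-checked; «S⁺ ⟹ S» needs Dedekind–Kummer for the `o = 1` coprimality — not glued, as the sketch says.) -/
theorem generatesPrimeOverC_of_oddPower_one {c : ℤ[X]} {p : ℕ} {a : ZMod p} {g : ℤ[X]}
    (h : GeneratesOddPrimePowerOverC c p a g 1) : GeneratesPrimeOverC c p a g := by
  obtain ⟨-, hdeg, hdet, hev, -⟩ := h
  exact ⟨hdeg, by simpa using hdet, hev⟩

/-! ### The five data (for the census; each satisfies `CubicDatumFor` for the named minimal model — checked in PARI, `polredabs` cubics with `ℤ[θ] = 𝓞_L`) -/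

/-- **DESC-35-H `SpinSettingCubicClassNumberOdd` (CONSEQUENCE OF PRINT — not a crux; explains why search51 found no even class number, MEMO-desc §35-add4).**
In the §35 setting the class number of the cubic field `L = ℚ(θ)`, `c(θ) = 0`, is ODD: Brumer–Kramer's local analysis makes `W` «nice» at every finite prime
(odd `v`: `[W(ℚ_v) : W₀(ℚ_v)] = c_v` odd; `v = 2`: good reduction), whence `dim C_L^∞[2] ≤ dim Sel₂(W/ℚ) = 0` for the semi-narrow class group `C_L^∞ ↠ C_L`
[cite: YooYu2022, Thm. 1.6 (K = ℚ), Thm. 1.10] [cite: BrumerKramer1977, §7] [cite: Li2019SelmerClassGroups, Thm. 1.1 (negative squarefree cubic discriminant — -desc's locator, paper not held)].  Hence `DegOnePrimesOddClassC c` holds whenever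
`ℤ[θ] = 𝓞_L` (Dedekind–Kummer), i.e. DESC-35-S⁺ carries no class-group hypothesis for monogenic `L`.  Data: 123 FIELD rows of ENGINES 50/51 (class numbers
`1, 3, 5, 7, 9, 15`, all odd; narrow class number odd in 122 — the exception `N = 1405` is totally real, where only `C_L^∞` is forced odd); search51 (kit j332956): 0 even of 104.
(Typer -ty g19, REF1-AUDIT §208: **SURVIVES, CONSEQUENCE OF PRINT** (plain ✓), verified at the page: [cite: YooYu2022, Thm. 1.6, Thm. 1.10 (K = ℚ: nice at odd v ⟸ the index of E₀(ℚ_v) in E(ℚ_v) is odd, at 2 ⟸ good reduction)]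
— apply to the monic integral model `Y² = X³ + b₂X² + 8b₄X + 16b₆` (`X = 4x`, `Y = 4(2y + a₁x + a₃)`; same cubic field `L`): `ℓ ∣ N` nice since `c_ℓ` is odd (a factor of an odd
product), good odd `v` index 1, `v = 2` unramified with good reduction (`N` odd) ⟹ nice everywhere ⟹ `dim C^∞_L[2] ≤ dim Sel₂(W) = 0` (`C^∞` the semi-narrow class group, Rem.
2.4: `↠ C_L`) ⟹ `h_L` odd = the typed conclusion.  MUTATION (REF1): `Squarefree N` and `Even a₂` of `SpinSetting` are NOT used — harmless extra hypotheses.  R208d(3): a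
Literature-fact candidate (statement-only, cite tags verbatim) rather than a proof target — not vendored by this port (F1Sign2 keeps -desc's `∀ W` form).  Data: 123 FIELD rows
of ENGINES 50/51 all odd; search51 0 even of 104.  Cite brackets split.  FOLD -ty g19 (REF2 16:11:40Z nit n4, KEY COLLISION): -desc's third source was tagged `Li2018`, which in `references.bib` is Wen-Wei Li's LNM «Zeta
Integrals, Schwartz Spaces and Local Functional Equations» — NOT the intended Chao Li, «2-Selmer groups, 2-class groups and rational points on elliptic curves», Trans. AMS 371
(2019) 4631–4653 (doi 10.1090/tran/7373; = Yoo–Yu's reference [Li19]); re-tagged to the new key `Li2019SelmerClassGroups` (added by the typer).) -/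
def SpinSettingCubicClassNumberOdd : Prop :=
  ∀ (W : WeierstrassCurve ℚ) [W.IsElliptic] [W.IsGloballyMinimal], SpinSetting W →
    ∀ (c xnum : ℤ[X]) (xden : ℕ), CubicDatumFor W c xnum xden →
      ∀ (K : Type) [Field K] [NumberField K] (θ : K), Module.finrank ℚ K = 3 → aeval θ c = 0 → Odd (NumberField.classNumber K)

/-- `11a1 = [0,−1,1,−10,−20]`: `c = X³ − X² + X + 1` (disc `−44`), `e = (3θ² − 7θ + 4)/2`.
(Typer: datum VERBATIM; REF1 re-derived (b-invariants (−4,−20,−79), −Res = −44).) -/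
def cubicDatum11a1 : ℤ[X] × ℤ[X] × ℕ := (X ^ 3 - X ^ 2 + X + 1, 3 * X ^ 2 - 7 * X + 4, 2)

/-- `37b3 = [0,1,1,−3,1]`: `c = X³ − X² − 3X + 1` (disc `148`), `e = (−θ² − θ + 2)/2`.
(Typer: datum VERBATIM; REF1: −Res = 148.) -/
def cubicDatum37b3 : ℤ[X] × ℤ[X] × ℕ := (X ^ 3 - X ^ 2 - 3 * X + 1, -X ^ 2 - X + 2, 2)

/-- `67a1 = [0,1,1,−12,−21]`: `c = X³ − X² − 3X + 5` (disc `−268`), `e = (θ² − 3θ − 2)/2`.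
(Typer: datum VERBATIM; REF1: −Res = −268.) -/
def cubicDatum67a1 : ℤ[X] × ℤ[X] × ℕ := (X ^ 3 - X ^ 2 - 3 * X + 5, X ^ 2 - 3 * X - 2, 2)

/-- `141d1 = [0,1,1,−26,−61]`: `c = X³ − X² − 5X + 3` (disc `564`), `e = (2θ² + 3θ − 9)/2`.
(Typer: datum VERBATIM; REF1: −Res = 564.) -/
def cubicDatum141d1 : ℤ[X] × ℤ[X] × ℕ := (X ^ 3 - X ^ 2 - 5 * X + 3, 2 * X ^ 2 + 3 * X - 9, 2)

/-- `446a1 = [1,1,0,−30,52]` (§34): `c = X³ − X² − 8X + 10` (disc `892`), `e = (7θ² + 2θ − 42)/4`.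
(Typer: datum VERBATIM (= §34's `cubic446`, `xnum446`, `xden = 4`); REF1: −Res = 892.) -/
def cubicDatum446a1 : ℤ[X] × ℤ[X] × ℕ := (X ^ 3 - X ^ 2 - 8 * X + 10, 7 * X ^ 2 + 2 * X - 42, 4)

end Summit.BirchSwinnertonDyer.Rank1Residual.F1Sign2

end
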